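/-
Copyright (c) 2026 the pub-hodgecm-mathlib formalisation cell (harness21).  Prover seat hodgecm-mathlib-LH4-p06 (g5), Track A «(D-RAM) FOUR-FRAME», unit U2H, census leaf
(ρ2b′-X) `stub_U2H_fixedPointCensus_typeTwo_unit0` — T5c «TORIC LEVEL CENSUS, M∕E-RAMIFIED»: (D3-LAW) the `ε`-WINDOW of the RamM census (LH4-p04 (g4)'s T5s-RamM letter
`hε : ε = −1 → jλ + 2 ≤ m + 2g + s0`; his open realizability item S6b-RM).  2026-09-04.
-/
import Summits.HodgeConjecture.HodgeConjecture.Theorems.F0P3cDyRamToricLevelCensusRamMTopLawPack   -- ★ p857870∕880∕886 (this seat): packaged law; brings ★ `…TopLawSide` (constancy, exclusivity)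
import HarnessLib

/-!
# T5c (D3-LAW): the `ε`-window — beyond the threshold at the radius of `κ` itself every deeper cell is of class T

Cell `hodgecm-mathlib` (D-0151), FLOOR 0, crux H413 = `stmt-HodgeConjecture-24833`; squad F0∕P3c∕LH4; lane `--supports stmt-HodgeConjecture-24833 --as helper` (count-neutral).
THEOREMS ONLY (no `def`, no instance, no notation, no `sorry`, default heartbeats).  Socket served: the realizability of LH4-p04 (g4)'s T5s-RamM token window
`hε : ε = 1 ∨ (ε = −1 ∧ jl + 2 ≤ m + 2g + s0)` (★ p857711; his closing note's open item «S6b-RK∕RM realizability inside my heads' token sets»):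
* `twistNear_one` — `κ = ρμ∕μ` is of class T at its OWN radius `|κ − 1| = exp(2m − 2jλ − d_ρ)` (`ω = 1`);
* **`not_anchoredNear_of_threshold_le_ell`** — with `ℓ := jλ − m` at K♮-level `kℓ` (`2(d′ + kℓ) + 2m = 2jλ + d_ρ`): if `dΘ ≤ kℓ + 1` (the cell at `κ`'s own radius is already
  beyond the non-norm threshold) then at every deeper level `k′ ≥ kℓ` the class E (the `−` side's anchored class) is DEAD (★ `twist_near_of_twist_near_of_near` + ★
  `not_twist_near_and_anchored_of_threshold_le`).  Contrapositive in LH4-p04's letters (`kℓ = ℓ − s0`, `dΘ = 2g`): the `−` side carries far cells (`ε = −1`) only if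
  `jλ − m ≤ 2g + s0 − 2`, i.e. `jλ + 2 ≤ m + 2g + s0`.
HONEST LABEL.  Count-neutral (`--supports`); unconditional local algebra; nothing of (ρ2b′-X) is asserted — `HC_CM` is proved only modulo the 7 printed citations (2 remaining named
inputs: hLiu418 = `stmt-HodgeConjecture-24832`, h413 = `stmt-HodgeConjecture-24833`) until rung 0 closes.

## References
* [Serre1979] J.-P. Serre, *Local Fields*, GTM 67 (1979): Ch. V §1; Ch. V §3 Cor. 3.
* [Kottwitz1986BaseChangeUnits] R. E. Kottwitz, *Base change for unit elements of Hecke algebras*, Compositio Math. 60 (1986): §1 pp. 240–241.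
-/

set_option autoImplicit false

noncomputable section

namespace Summit.HodgeConjecture.HodgeConjecture.Cruxes.H413.F0P3cDyRamToricLevelCensusRamM

open WithZero IsLocalRing
open scoped Valued
open Literature.NumberTheory.Automorphic.UnitaryThreeFourFrame (IsRamifiedQuadraticDatum)
open Literature.NumberTheory.LocalFields.QuadraticOrder Literature.NumberTheory.LocalFields.WildQuadraticDatum

variable {K : Type} [Field K] [Valued K ℤᵐ⁰] {ρ Θ : K →+* K} {α ϖE : K} {dρ t : ℕ}
variable {K' : Type*} [Field K'] [Valued K' ℤᵐ⁰] {σ' : K' →+* K'} {π' : K'} {d' : ℕ}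

/-- **`κ` IS OF CLASS T AT ITS OWN RADIUS** (`ω = 1`: `t(1) = 1`, `|κ·1 − 1| = |κ − 1|`). [cite: Serre1979, Ch. V §1] -/
theorem twistNear_one (κ : K) {r : ℤᵐ⁰} (hκ : Valued.v (κ - 1) ≤ r) :
    ∃ ω : K, Valued.v ω = 1 ∧ Valued.v (κ * (ρ (ω * Θ ω) / (ω * Θ ω)) - 1) ≤ r :=
  ⟨1, Valuation.map_one _, by rwa [one_mul, map_one, map_one, div_one, mul_one]⟩

/-- **THE `ε`-WINDOW OF THE RamM CENSUS (LH4-p04 (g4)'s `hε : ε = −1 → jλ + 2 ≤ m + 2g + s0`, realizability S6b-RM).**  With `ℓ := jλ − m` and its K♮-level `kℓ`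
(`2(d′ + kℓ) + 2m = 2jλ + d_ρ`): `κ` is of class T at radius `|jK π′^{d′+kℓ}| = |κ − 1|` (★ `twistNear_one`); so if that cell is already BEYOND the threshold (`dΘ ≤ kℓ + 1`),
then at every deeper cell `k′ ≥ kℓ` the class E is DEAD (★ constancy + ★ exclusivity) — the `−` side can carry far cells only when `jλ − m ≤ dΘ + s0 − 2`, i.e. inside
`jλ + 2 ≤ m + 2g + s0`. [cite: Serre1979, Ch. V §3 Cor. 3] [cite: Kottwitz1986BaseChangeUnits, §1 pp. 240–241] -/
theorem not_anchoredNear_of_threshold_le_ell [CompleteSpace K] [Finite 𝓀[K]]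
    (hD : IsRamifiedQuadraticDatum ρ α dρ t) (hvΘ : ∀ x, Valued.v (Θ x) = Valued.v x)
    (hσ' : ∀ x, σ' (σ' x) = x) (hvσ' : ∀ x, Valued.v (σ' x) = Valued.v x) (hfix' : ∀ x : K', σ' x = x → x ≠ 0 → ∃ n : ℤ, Valued.v x = exp (2 * n))
    (hπ' : Valued.v π' = exp (-1 : ℤ)) (hdd' : Valued.v (π' - σ' π') = Valued.v π' ^ d')
    (jK : K' →+* K) (hjle : ∀ x y : K', Valued.v (jK x) ≤ Valued.v (jK y) ↔ Valued.v x ≤ Valued.v y) (hjΘ : ∀ x, Θ (jK x) = jK x)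
    (hjfix : ∀ z : K, Θ z = z → ∃ x, jK x = z) (hjσ : ∀ x, jK (σ' x) = ρ (jK x)) (hjπ : Valued.v (jK π') = exp (-2 : ℤ))
    {ϖ : K} {dΘ tΘ : ℕ} (hDΘ : IsRamifiedQuadraticDatum Θ ϖ dΘ tΘ)
    (hFN : ∀ f : K, ρ f = f → Θ f = f → Valued.v f = 1 → ∃ x : K, x * Θ x = f)
    {n₀ : K} (hΘn₀ : Θ n₀ = n₀) (hn₀1 : Valued.v n₀ = 1) (hn₀N : ¬ ∃ z : K, z * Θ z = n₀)
    (hϖE : Valued.v ϖE = exp (-2 : ℤ)) {μ : K} {m jl : ℕ} (hμ : Valued.v μ = Valued.v ϖE ^ m) (hjl : Valued.v (μ - ρ μ) = Valued.v (ϖE ^ jl * (α - ρ α)))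
    {kℓ : ℕ} (hkℓ : 2 * ((d' : ℤ) + kℓ) + 2 * m = 2 * jl + dρ) (hthr : dΘ ≤ kℓ + 1) {k' : ℕ} (hk : kℓ ≤ k') :
    ¬ ∃ ω : K, Valued.v ω = 1 ∧ Valued.v (ρ μ / μ * (ρ n₀ / n₀) * (ρ (ω * Θ ω) / (ω * Θ ω)) - 1) ≤ Valued.v (jK π' ^ (d' + k')) := by
  obtain ⟨hρρ, hvρ, -, -, -, -, -⟩ := id hD
  have hμ0 : μ ≠ 0 := fun h0 => by
    rw [h0, map_zero, v_varpiE_pow hϖE] at hμ; exact exp_ne_zero hμ.symm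
  have hκ1 : Valued.v (ρ μ / μ) = 1 := (token_twist_mu hρρ hvρ hμ0).2
  -- class T at the radius of `κ`: `|κ − 1| = exp(2m − 2jλ − d_ρ) = |jK π′^{d′+kℓ}|`
  have hκ : Valued.v (ρ μ / μ - 1) ≤ Valued.v (jK π' ^ (d' + kℓ)) := by
    rw [← neg_sub, Valuation.map_neg, v_one_sub_twist_eq_ramified hD hϖE hμ hjl, v_map_pow_eq_exp_neg_two_mul jK hjπ, exp_le_exp]
    push_cast; omega
  intro hE
  have hT := twist_near_of_twist_near_of_near hvρ hvΘ hσ' hvσ' hfix' hπ' hdd' jK hjle hjΘ hjfix hjσ hjπ hDΘ hFN hΘn₀ hn₀1 hn₀N hthr hk hκ1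
    (twistNear_one (ρ μ / μ) hκ) (Or.inr hE)
  exact not_twist_near_and_anchored_of_threshold_le hvρ hvΘ hσ' hvσ' hfix' hπ' hdd' jK hjle hjΘ hjfix hjσ hjπ hDΘ hFN hΘn₀ hn₀1 hn₀N
    (show dΘ ≤ k' + 1 by omega) hκ1 ⟨hT, hE⟩

end Summit.HodgeConjecture.HodgeConjecture.Cruxes.H413.F0P3cDyRamToricLevelCensusRamM

end
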